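import Literature.Topology.FourManifolds.CobordismAttachment
import Literature.Topology.FourManifolds.CobordismBoundaryData
import Literature.Topology.FourManifolds.CollarTheorem
import Literature.Topology.FourManifolds.SphereSimplyConnected
import Literature.AlgebraicTopology.Homotopy.CollarGluing
import HarnessLib

/-!
# `W ∪_ψ X` is simply connected when `W`, `X` are and the seam is connected (van Kampen)

Topic `Literature/Topology/FourManifolds`; in the cone of the named fact
`Literature.Topology.FourManifolds.isHCobordant_of_equivalent_intersectionForm` (**Wall 1964,
Thm. 2**; C. T. C. Wall, *On simply-connected 4-manifolds*, J. London Math. Soc. 39 (1964)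
141–149; `HCobordismDonaldson.lean`). Wall's h-cobordism `R` between `M₁` and `M₂` is built by
gluing (p. 145: "We now take the h-cobordism of `M₁ # (−M₂)` to `∂V`, and 'fill in' `∂V` by
attaching `V` … and fill in `S³ × I` by attaching `D⁴ × I`"), and the first claim about it is
(p. 146): **"First, it is clear from construction that `R` is simply-connected."** The construction
behind "clear" is van Kampen's theorem for a manifold with a cobordism attached along its boundary,
which this file PROVES for the tree's witness structure
`Literature.Topology.FourManifolds.CobordismAttachment` (`V = W ∪_ψ X`, Milnor 1965, Thm. 1.4):

* `Cobordism.exists_boundaryCollar_inl` — **a topological collar of the incoming end of a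
  cobordism** `X = (X; M, N)` with compact smooth ends: a closed embedding `κ : M × [0, 1] → X`
  with `κ (M × [0, 1))` open and `κ (x, 0) = inl x` (the smooth collar theorem of the tree,
  `BoundaryData.nonempty_collar_of_compactSpace`, Hirsch 1976 Thm. 4.6.1 / Milnor 1965 §1, applied
  to the boundary datum `∂X = M ⊔ N` and restricted to the open-and-closed part `M`).
* `BoundaryCollar.GluingData.simplyConnectedSpace_of_simplyConnectedSpace` — **van Kampen for a
  gluing along the bottom of a collar** (the tree's `BoundaryCollar.GluingData`,
  `CollarGluing.lean`): if both pieces `W₁`, `W₂` are simply connected and the seam `A` is path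
  connected, the glued space `P` is simply connected — the open cover `U ∪ V = P` of
  `CollarGluing.lean` has `U ≃ W₁`, `V ≃ W₂` (homotopy equivalences by squeezing the collar) and
  `U ∩ V ≅ A × (0, t)` path connected, so Hatcher's Lemma 1.15
  (`simplyConnectedSpace_of_isOpen_union`) applies. (`CollarGluing.lean` itself records only the
  variant with `W₁` contractible and `π₁(A) → π₁(W₂)` onto, for corks.)
* `CobordismAttachment.collarGluingData` — an attachment `V = W ∪_ψ X` IS such a gluing (pieces
  `jW`, `jX`, collar of the incoming end of `X` reparametrised by `ψ : ∂W ≅ M`).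
* `CobordismAttachment.simplyConnectedSpace` — **`W ∪_ψ X` is simply connected** for `W`, `X`
  simply connected and `M` (path) connected; `CobordismAttachment.pathConnectedSpace` likewise.

Everything is proved; no named fact and no definition of mathematical content is introduced (the
two `def`s are structure-valued bridges). Stated for attachments in total dimension `n + 2 ≥ 2`
(where collars exist), all types in one universe.

## References

* C. T. C. Wall, *On simply-connected 4-manifolds*, J. London Math. Soc. 39 (1964) 141–149, §2
  pp. 145–146. [WallJLMS1964]
* J. Milnor, *Lectures on the h-cobordism theorem*, Princeton (1965), §1, Thm. 1.4.
  [MilnorHCobordism1965]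
* A. Hatcher, *Algebraic Topology*, CUP (2002), Lemma 1.15, Prop. 3.42. [HatcherAT2002]
* M. W. Hirsch, *Differential Topology* (1976), Thm. 4.6.1. [Hirsch1976]
-/

open scoped Manifold ContDiff Topology unitInterval
open Set Function Topology
open Literature.AlgebraicTopology.Homotopy

noncomputable section

universe u

namespace Literature.Topology.FourManifolds

/-! ### A topological collar of the incoming end of a cobordism -/

section InlCollar

variable {n : ℕ} {M N : Type u} [TopologicalSpace M] [ChartedSpace (EuclideanSpace ℝ (Fin (n + 1))) M]
  [TopologicalSpace N] [ChartedSpace (EuclideanSpace ℝ (Fin (n + 1))) N]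

/-- **A topological collar of the incoming end of a cobordism**: for a cobordism `X` from `M` to
`N` (compact smooth `(n+1)`-manifolds, total space of dimension `n + 2`) there is a closed
embedding `κ : M × [0, 1] → X` with `κ (M × [0, 1))` open in `X` and `κ (x, 0) = inl x`
(`BoundaryCollar`, `CollarPush.lean`). From the smooth collar of the whole boundary
`∂X = inl(M) ⊔ inr(N)` (`BoundaryData.nonempty_collar_of_compactSpace` for `Cobordism.boundaryDataSum`;
Hirsch 1976, Thm. 4.6.1; Milnor 1965, §1 "collar neighbourhood") restricted to the open-and-closed
summand `M`. [cite: Hirsch1976, Thm. 4.6.1] [cite: MilnorHCobordism1965, §1] -/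
theorem Cobordism.exists_boundaryCollar_inl [IsManifold (𝓡 (n + 1)) ∞ M] [IsManifold (𝓡 (n + 1)) ∞ N]
    [CompactSpace M] [CompactSpace N] (X : Cobordism (n + 1) M N) :
    ∃ κ : BoundaryCollar X.W M, ∀ x : M, κ.collar (x, 0) = X.inl x := by
  obtain ⟨col⟩ := BoundaryData.nonempty_collar_of_compactSpace n X.W X.boundaryDataSum
  -- the collar of `∂X = M ⊔ N`, read on the carrier `M ⊕ N` (definitionally the carrier of
  -- `boundaryDataSum`)
  let c : (M ⊕ N) × Icc (0 : ℝ) 1 → X.W := col.toFun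
  have hc : IsEmbedding c := col.isSmoothEmbedding.isEmbedding
  have hco : IsOpen (c '' {p | (p.2 : ℝ) < 1}) := col.isOpen_image
  have hc0 : ∀ x : M, c (Sum.inl x, ⊥) = X.inl x := fun x => col.apply_bot (Sum.inl x)
  -- its restriction to the summand `M`
  let ι : M × I → (M ⊕ N) × Icc (0 : ℝ) 1 := fun q => (Sum.inl q.1, q.2)
  have hι : Continuous ι :=
    (Continuous.comp _root_.continuous_inl continuous_fst).prodMk continuous_snd
  have hιi : Injective ι := fun q q' h => by
    simp only [ι, Prod.mk.injEq, Sum.inl.injEq] at h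
    exact Prod.ext h.1 h.2
  let f : M × I → X.W := fun q => c (ι q)
  have hf : Continuous f := hc.continuous.comp hι
  have hfi : Injective f := hc.injective.comp hιi
  refine ⟨⟨f, hf.isClosedEmbedding hfi, ?_⟩, fun x => hc0 x⟩
  -- `f (M × [0, 1)) = c ({inl} × [0, 1))` is open: `c` restricted to `∂X × [0, 1)` is an open
  -- embedding and `inl(M) × [0, 1)` is open in `∂X × [0, 1]`
  set T : Set ((M ⊕ N) × Icc (0 : ℝ) 1) := {p | (p.2 : ℝ) < 1} with hT
  have hemb : IsOpenEmbedding (T.restrict c) := by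
    refine ⟨hc.comp IsEmbedding.subtypeVal, ?_⟩
    rw [Set.range_restrict]
    exact hco
  set S : Set ((M ⊕ N) × Icc (0 : ℝ) 1) := {p | p.1 ∈ range Sum.inl ∧ (p.2 : ℝ) < 1} with hS
  have hSo : IsOpen S :=
    (isOpen_range_inl.preimage continuous_fst).inter
      (isOpen_lt (continuous_subtype_val.comp continuous_snd) continuous_const)
  have himage : f '' {q : M × I | q.2 < 1} = T.restrict c '' (Subtype.val ⁻¹' S) := by
    ext w
    simp only [mem_image, mem_setOf_eq, restrict_apply, mem_preimage, Subtype.exists,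
      exists_and_right]
    constructor
    · rintro ⟨q, hq, rfl⟩
      have hq' : ((q.2 : Icc (0 : ℝ) 1) : ℝ) < 1 := hq
      exact ⟨ι q, ⟨hq', ⟨⟨q.1, rfl⟩, hq'⟩⟩, rfl⟩
    · rintro ⟨⟨p₁, p₂⟩, ⟨hpT, ⟨⟨x, rfl⟩, hp1⟩⟩, rfl⟩
      exact ⟨(x, p₂), hp1, rfl⟩
  rw [himage]
  exact hemb.isOpenMap _ (hSo.preimage continuous_subtype_val)

end InlCollar

/-! ### Van Kampen for a gluing along the bottom of a collar -/

section GluingVanKampen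

variable {W₁ : Type u} [TopologicalSpace W₁] {W₂ : Type u} [TopologicalSpace W₂]
  {A : Type u} [TopologicalSpace A] {κ : BoundaryCollar W₂ A} {i₁ : A → W₁}
  {P : Type u} [TopologicalSpace P]

/-- **Van Kampen for a gluing along the bottom of a collar** (Hatcher 2002, Lemma 1.15 with
Prop. 3.42): if `P` is the gluing of `W₁` and the collared `W₂` along `i₁(A) ≡ κ(A × {0})`
(`BoundaryCollar.GluingData`) with `W₁`, `W₂` simply connected and `A` path connected, then `P` is
simply connected. The open cover `U 1`, `V` of `CollarGluing.lean` has `U 1 ≃ W₁`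
(`homotopyEquivU`), `V ≃ W₂` (`homotopyEquivV`) and `U 1 ∩ V ≅ κ (A × (0, 1))` path connected
(`isPathConnected_U_inter_V`); conclude by `simplyConnectedSpace_of_isOpen_union`.
[cite: HatcherAT2002, Lemma 1.15 and Prop. 3.42] -/
theorem _root_.Literature.AlgebraicTopology.Homotopy.BoundaryCollar.GluingData.simplyConnectedSpace_of_simplyConnectedSpace
    (d : κ.GluingData i₁ P) [SimplyConnectedSpace W₁] [SimplyConnectedSpace W₂]
    [PathConnectedSpace A] : SimplyConnectedSpace P := by
  haveI : Nonempty A := PathConnectedSpace.nonempty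
  have ht : (0 : I) < 1 := zero_lt_one
  have hU : IsSimplyConnected (d.U 1) := (d.homotopyEquivU ht).symm.simplyConnectedSpace
  have hV : IsSimplyConnected d.V := (d.homotopyEquivV ht).simplyConnectedSpace
  exact simplyConnectedSpace_of_isOpen_union (d.isOpen_U 1) d.isOpen_V (d.U_union_V ht) hU hV
    (d.isPathConnected_U_inter_V ht)

end GluingVanKampen

/-! ### An attachment `W ∪_ψ X` is a gluing along the bottom of a collar -/

section Attachment

variable {n : ℕ} {W : Type u} [TopologicalSpace W] [ChartedSpace (EuclideanHalfSpace (n + 2)) W]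
  {M N : Type u} [TopologicalSpace M] [ChartedSpace (EuclideanSpace ℝ (Fin (n + 1))) M]
  [TopologicalSpace N] [ChartedSpace (EuclideanSpace ℝ (Fin (n + 1))) N]
  {b : BoundaryData (𝓡∂ (n + 2)) W (𝓡 (n + 1))} {X : Cobordism (n + 1) M N}
  {ψ : b.carrier ≃ₘ⟮𝓡 (n + 1), 𝓡 (n + 1)⟯ M} {V : Type u} [TopologicalSpace V]
  [ChartedSpace (EuclideanHalfSpace (n + 2)) V]

/-- **Reparametrising a collar of the incoming end `M` of `X` by `ψ : ∂W ≅ M`**: the closed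
embedding `(z, t) ↦ κ (ψ z, t)`, a boundary collar of `X` parametrised by `∂W`. [folklore] -/
def _root_.Literature.AlgebraicTopology.Homotopy.BoundaryCollar.precompHomeomorph
    {Y : Type u} [TopologicalSpace Y] {B C : Type u} [TopologicalSpace B] [TopologicalSpace C]
    (κ : BoundaryCollar Y C) (e : B ≃ₜ C) : BoundaryCollar Y B where
  collar q := κ.collar (e q.1, q.2)
  isClosedEmbedding_collar :=
    κ.isClosedEmbedding_collar.comp (e.prodCongr (Homeomorph.refl I)).isClosedEmbedding
  isOpen_image := by
    have h : (fun q : B × I => κ.collar (e q.1, q.2)) '' {q | q.2 < 1} =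
        κ.collar '' {q | q.2 < 1} := by
      ext y
      simp only [mem_image, mem_setOf_eq]
      constructor
      · rintro ⟨q, hq, rfl⟩
        exact ⟨(e q.1, q.2), hq, rfl⟩
      · rintro ⟨q, hq, rfl⟩
        exact ⟨(e.symm q.1, q.2), hq, by rw [e.apply_symm_apply]⟩
    rw [h]
    exact κ.isOpen_image

/-- The reparametrised collar on points. [folklore] -/
@[simp] theorem _root_.Literature.AlgebraicTopology.Homotopy.BoundaryCollar.precompHomeomorph_collar
    {Y : Type u} [TopologicalSpace Y] {B C : Type u} [TopologicalSpace B] [TopologicalSpace C]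
    (κ : BoundaryCollar Y C) (e : B ≃ₜ C) (q : B × I) :
    (κ.precompHomeomorph e).collar q = κ.collar (e q.1, q.2) := rfl

/-- **An attachment `V = W ∪_ψ X` is a gluing along the bottom of a collar** (Milnor 1965,
Thm. 1.4, topological content): given a collar `κ` of the incoming end of `X` with
`κ (x, 0) = inl x`, the pieces `jW : W → V`, `jX : X → V` (closed embeddings, `W` and `X` being
compact and `V` Hausdorff) and the collar `(z, t) ↦ κ (ψ z, t)` form `BoundaryCollar.GluingData`
with seam map `b.incl : ∂W → W`: `jW w = jX x ↔ ∃ z, w = incl z ∧ x = κ (ψ z, 0)`.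
[cite: MilnorHCobordism1965, §1, Thm. 1.4] -/
def CobordismAttachment.collarGluingData [CompactSpace W] [T2Space V] (At : CobordismAttachment b X ψ V)
    (κ : BoundaryCollar X.W M) (hκ : ∀ x : M, κ.collar (x, 0) = X.inl x) :
    (κ.precompHomeomorph ψ.toHomeomorph).GluingData b.incl V where
  j₁ := At.jW
  j₂ := At.jX
  isClosedEmbedding_j₁ := At.continuous_jW.isClosedEmbedding At.injective_jW
  isClosedEmbedding_j₂ := At.continuous_jX.isClosedEmbedding At.injective_jX
  range_union_range := At.range_union
  j₁_eq_j₂_iff w x := by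
    rw [At.jW_eq_jX_iff]
    refine exists_congr fun z => ?_
    rw [BoundaryCollar.precompHomeomorph_collar, hκ]
    rfl

/-- **`W ∪_ψ X` is path connected when `W` and `X` are** (and `∂W` is nonempty).
[cite: MilnorHCobordism1965, §1, Thm. 1.4] -/
theorem CobordismAttachment.pathConnectedSpace [CompactSpace W] [T2Space V]
    [IsManifold (𝓡 (n + 1)) ∞ M] [IsManifold (𝓡 (n + 1)) ∞ N] [CompactSpace M] [CompactSpace N]
    [PathConnectedSpace W] [PathConnectedSpace X.W] [Nonempty M]
    (At : CobordismAttachment b X ψ V) : PathConnectedSpace V := by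
  obtain ⟨κ, hκ⟩ := X.exists_boundaryCollar_inl
  haveI : Nonempty b.carrier := ⟨ψ.symm (Classical.arbitrary M)⟩
  exact (At.collarGluingData κ hκ).pathConnectedSpace

/-- **"It is clear from construction that `R` is simply-connected"** (Wall 1964, p. 146) — **van
Kampen for `W ∪_ψ X`**: if the compact manifold with boundary `W` and the (total space of the)
cobordism `X` from `M` to `N` are simply connected and `M ≅ ∂W` is connected, then every
attachment `V = W ∪_ψ X` (Milnor 1965, Thm. 1.4; `CobordismAttachment b X ψ V`, `V` Hausdorff) is
simply connected. Proof: `V` is a gluing along the bottom of a collar of the incoming end of `X`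
(`CobordismAttachment.collarGluingData`, `Cobordism.exists_boundaryCollar_inl`), to which van Kampen in
the form `GluingData.simplyConnectedSpace_of_simplyConnectedSpace` applies. PROVED.
[cite: WallJLMS1964, §2 p. 146] [cite: HatcherAT2002, Lemma 1.15 and Prop. 3.42] [cite: MilnorHCobordism1965, §1, Thm. 1.4] -/
theorem CobordismAttachment.simplyConnectedSpace [CompactSpace W] [T2Space V]
    [IsManifold (𝓡 (n + 1)) ∞ M] [IsManifold (𝓡 (n + 1)) ∞ N] [CompactSpace M] [CompactSpace N]
    [SimplyConnectedSpace W] [SimplyConnectedSpace X.W] [PathConnectedSpace M]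
    (At : CobordismAttachment b X ψ V) : SimplyConnectedSpace V := by
  obtain ⟨κ, hκ⟩ := X.exists_boundaryCollar_inl
  haveI : PathConnectedSpace b.carrier :=
    ψ.toHomeomorph.symm.surjective.pathConnectedSpace ψ.toHomeomorph.symm.continuous
  exact (At.collarGluingData κ hκ).simplyConnectedSpace_of_simplyConnectedSpace

end Attachment

end Literature.Topology.FourManifolds

end
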